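import Summits.HodgeConjecture.CorCM.GaloisThirtyTwoFrattiniDegenerate
import Summits.HodgeConjecture.CorCM.TwoGroupCentralElementarySplitting
import Summits.HodgeConjecture.CorCM.CentralInvolutionComplement
import Summits.HodgeConjecture.CorCM.GaloisTwoPowerDescentLemmas
import HarnessLib

/-!
# Degree `32`: (H2) and central involutions give the structure `Gal = H·E` — the size-free (R1)

COR-CM (cell `pub-hodgecm2`), binder seat b04 (gen 36), count-neutral own lane «Galois-CM-type classification».  KERNEL ONLY:
theorems; no definition, no named fact, no `sorry`.  `HC_CM` is neither used nor claimed.  ORDER-`32` BASE programme (A7-JUNCTION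
gen-36 addendum): the degree-`32` form of gen 34's (R1) `CorCM/GaloisTwoPowerOrderFourClassification` (which needs `[K:ℚ] ≥ 64` twice:
for «involutions are central» and for «`|E| ≥ 4` ⟹ BAD»).

STRUCT(`K`) = `Gal(K/ℚ) = H·E`, `H.IsComplement' E`, `E` central of exponent `2`, `|E| ≤ 2`, `c ∈ H ∖ E`, `|H| = 2^k`, `H` cyclic
or `≃ QuaternionGroup (2^(k-2))` — i.e. `Gal ∈ {C₃₂, Q₃₂, C₁₆ × C₂ (c ∈ C₁₆), Q₁₆ × C₂ (c ∈ Q₁₆)}`, the conclusion of the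
`2`-power classification (`CorCM/GaloisTwoPowerClassification.struct_of_base` with `n₀ = 5`).  For `K` GOOD of degree `32`:

* **`struct_of_pow_four_sq_thirtytwo`** — if all involutions of `Gal(K/ℚ)` are CENTRAL and (H2) holds (`y⁴ = 1 ⟹ y² ∈ {1, c}`)
  then STRUCT: the complement `E` avoiding `c` (gen 34) and the complement `H` of gen 34's splitting exist size-free; `|E| ≥ 4`
  is excluded at degree `32` because then `H` is cyclic of order `≤ 8` (so `Gal` is abelian of exponent `≤ 8`, not thin — gens
  15–16) or `H ≅ Q₈` (so every square lies in `{1, c}` — BAD by `CorCM/GaloisThirtyTwoFrattiniDegenerate`).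
* `struct_of_involution_unique` — a unique involution ⟹ STRUCT with `E = 1` (Rotman 5.46, gen 34; any `2`-power degree).
* **`struct_of_comm_thirtytwo`** — `Gal(K/ℚ)` ABELIAN ⟹ STRUCT (thin by gens 15–16 ⟹ (H2) ⟹ the first theorem).

## References

* [Rotman1995] J. J. Rotman, *An Introduction to the Theory of Groups*, 4th ed., GTM 148, Thm. 5.46.
* [Shimura1998] G. Shimura, *Abelian Varieties with Complex Multiplication and Modular Functions*, §6.2 Thm. 3, §8.2 Prop. 26.
* [Kubota1965] T. Kubota, *On the field extension by complex multiplication*, Trans. AMS 118 (1965), §2 and §4 Lemma 2.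
* [Gordon1999HodgeAVSurvey] B. B. Gordon, *A survey of the Hodge conjecture for abelian varieties*, Thm. 6.4, §9.4.3.
-/

noncomputable section

open CategoryTheory CategoryTheory.Limits NumberField
open scoped BigOperators

namespace Summit.HodgeConjecture.CorCM.GaloisModels

open Literature.NumberTheory.ComplexMultiplication
open Literature.AlgebraicGeometry.Motives (AbelianVariety CMType)
open Literature.AlgebraicGeometry.HodgeTheory
open Literature.AlgebraicGeometry.Pohlmann1968
open Summit.HodgeConjecture.CorCM.GaloisRank
open Summit.HodgeConjecture.CorCM.GaloisModels.UniqueInvolution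

section Field

variable {K : Type} [Field K] [NumberField K] [IsCMField K] [IsGalois ℚ K]

/-- **(R1) at degree `32`.**  `K` Galois CM of degree `32`, GOOD, every involution of `Gal(K/ℚ)` central, and (H2): `y⁴ = 1 ⟹
y² ∈ {1, c}`.  Then `Gal(K/ℚ) = H·E` with `E` central of exponent `2` and order `≤ 2`, `c ∈ H ∖ E`, `H` cyclic or generalised
quaternion. [cite: Rotman1995, Thm. 5.46] [cite: Shimura1998, §6.2 Thm. 3 and §8.2 Prop. 26] [cite: Kubota1965, §2 and §4 Lemma 2]
[cite: Gordon1999HodgeAVSurvey, Thm. 6.4 and §9.4.3] -/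
theorem struct_of_pow_four_sq_thirtytwo (hdeg : Module.finrank ℚ K = 32)
    (hgood : ∀ (Φ : CMType K) (φ : K →+* ℂ), IsPrimitive (ℂ ≃+* ℂ) Φ.1 φ → IsNondegenerate Φ)
    (hinv : ∀ s : K ≃ₐ[ℚ] K, s * s = 1 → ∀ g : K ≃ₐ[ℚ] K, g * s = s * g)
    (hH2 : ∀ y : K ≃ₐ[ℚ] K, y ^ 4 = 1 → y * y = 1 ∨ y * y = (IsCMField.complexConj K).restrictScalars ℚ) :
    ∃ (H E : Subgroup (K ≃ₐ[ℚ] K)) (k : ℕ), H.IsComplement' E ∧ (IsCMField.complexConj K).restrictScalars ℚ ∈ H ∧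
      (IsCMField.complexConj K).restrictScalars ℚ ∉ E ∧ (∀ e ∈ E, e * e = 1 ∧ ∀ g : K ≃ₐ[ℚ] K, g * e = e * g) ∧
      Nat.card E ≤ 2 ∧ Nat.card H = 2 ^ k ∧ (IsCyclic H ∨ (3 ≤ k ∧ Nonempty (H ≃* QuaternionGroup (2 ^ (k - 2))))) := by
  classical
  set c := (IsCMField.complexConj K).restrictScalars ℚ with hc
  have hcc : c * c = 1 := model_complexConj_mul_self (MulEquiv.refl (K ≃ₐ[ℚ] K)) (by simp [hc])
  have hc1 : c ≠ 1 := model_complexConj_ne_one (MulEquiv.refl (K ≃ₐ[ℚ] K)) (by simp [hc])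
  have hccen : ∀ g : K ≃ₐ[ℚ] K, g * c = c * g := fun g =>
    (model_complexConj_comm (MulEquiv.refl (K ≃ₐ[ℚ] K)) (by simp [hc]) g).symm
  have hcardF : Fintype.card (K ≃ₐ[ℚ] K) = 32 := by rw [card_model_eq_finrank (MulEquiv.refl (K ≃ₐ[ℚ] K)), hdeg]
  have hcard : Nat.card (K ≃ₐ[ℚ] K) = 2 ^ 5 := by rw [Nat.card_eq_fintype_card, hcardF]; norm_num
  obtain ⟨E, hcE, hE, hΩ'⟩ := exists_complement_avoiding c hc1
  have hΩ : ∀ s : K ≃ₐ[ℚ] K, s * s = 1 → s ∈ E ∨ c * s ∈ E := fun s hs => hΩ' s hs (hinv s hs)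
  obtain ⟨H, k, hHE, hcH, hHcard, hstruct⟩ := exists_isComplement'_of_pow_four hcard hcc hccen E hcE hE hΩ hH2
  have hmul : Nat.card H * Nat.card E = 2 ^ 5 := by rw [hHE.card_mul, hcard]
  have hkle : k ≤ 5 := by
    have h1 : 2 ^ k ∣ 2 ^ 5 := by rw [← hHcard, ← hmul]; exact Dvd.intro _ rfl
    exact (Nat.pow_dvd_pow_iff_le_right (by norm_num)).1 h1
  -- `|E| ≤ 2` unless `k ≤ 3`
  by_cases hk : 4 ≤ k
  · refine ⟨H, E, k, hHE, hcH, hcE, hE, ?_, hHcard, hstruct⟩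
    have h16 : 16 ≤ Nat.card H := by
      rw [hHcard]
      exact le_trans (by norm_num) (Nat.pow_le_pow_right (by norm_num) hk : 2 ^ 4 ≤ 2 ^ k)
    have hEpos : 0 < Nat.card E := Nat.card_pos
    nlinarith [hmul, h16, hEpos]
  · exfalso
    push Not at hk
    -- the decomposition `g = h e`
    have hdec : ∀ g : K ≃ₐ[ℚ] K, ∃ h ∈ H, ∃ e ∈ E, g = h * e := fun g => by
      obtain ⟨⟨h, e⟩, hhe⟩ := hHE.2 g
      exact ⟨h, h.2, e, e.2, hhe.symm⟩
    have hH8 : Nat.card H ∣ 8 := by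
      rw [hHcard, show (8 : ℕ) = 2 ^ 3 by norm_num]
      exact Nat.pow_dvd_pow 2 (by omega)
    rcases hstruct with hcyc | ⟨hk3, ⟨f⟩⟩
    · /- `H` cyclic: `Gal` is abelian of exponent `≤ 8`, hence not thin — BAD, contradicting GOOD -/
      have hcomm : ∀ g₁ g₂ : K ≃ₐ[ℚ] K, g₁ * g₂ = g₂ * g₁ := by
        haveI : IsCyclic H := hcyc
        obtain ⟨z, hz⟩ := IsCyclic.exists_generator (α := H)
        intro g₁ g₂
        obtain ⟨h₁, hh₁, e₁, he₁, rfl⟩ := hdec g₁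
        obtain ⟨h₂, hh₂, e₂, he₂, rfl⟩ := hdec g₂
        obtain ⟨i, hi⟩ := Subgroup.mem_zpowers_iff.1 (hz ⟨h₁, hh₁⟩)
        obtain ⟨j, hj⟩ := Subgroup.mem_zpowers_iff.1 (hz ⟨h₂, hh₂⟩)
        have hi' : (z : K ≃ₐ[ℚ] K) ^ i = h₁ := by rw [← Subgroup.coe_zpow, hi]
        have hj' : (z : K ≃ₐ[ℚ] K) ^ j = h₂ := by rw [← Subgroup.coe_zpow, hj]
        have h12 : h₁ * h₂ = h₂ * h₁ := by rw [← hi', ← hj', ← zpow_add, ← zpow_add, add_comm]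
        calc h₁ * e₁ * (h₂ * e₂) = h₁ * (e₁ * h₂) * e₂ := by simp only [mul_assoc]
          _ = h₁ * (h₂ * e₁) * e₂ := by rw [(hE e₁ he₁).2 h₂]
          _ = (h₁ * h₂) * (e₁ * e₂) := by simp only [mul_assoc]
          _ = (h₂ * h₁) * (e₂ * e₁) := by rw [h12, (hE e₁ he₁).2 e₂]
          _ = h₂ * (h₁ * e₂) * e₁ := by simp only [mul_assoc]
          _ = h₂ * (e₂ * h₁) * e₁ := by rw [(hE e₂ he₂).2 h₁]
          _ = h₂ * e₂ * (h₁ * e₁) := by simp only [mul_assoc]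
      have hα : ¬ ∃ z : K ≃ₐ[ℚ] K, c ∈ Subgroup.zpowers z ∧ (Subgroup.zpowers z).index ≤ 2 := by
        rintro ⟨z, -, hidx⟩
        obtain ⟨h, hh, e, he, rfl⟩ := hdec z
        have h8 : (h * e) ^ 8 = 1 := by
          have hh8 : h ^ 8 = 1 := by
            have h1 : (⟨h, hh⟩ : H) ^ Nat.card H = 1 := pow_card_eq_one'
            obtain ⟨d, hd⟩ := hH8
            have h2 : (⟨h, hh⟩ : H) ^ 8 = 1 := by rw [hd, pow_mul, h1, one_pow]
            have := congrArg Subtype.val h2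
            simpa using this
          have he8 : e ^ 8 = 1 := by
            rw [show (8 : ℕ) = 2 * 4 by norm_num, pow_mul, pow_two, (hE e he).1, one_pow]
          rw [(show Commute h e from ((hE e he).2 h)).mul_pow, hh8, he8, one_mul]
        have hoz : orderOf (h * e) ≤ 8 := Nat.le_of_dvd (by norm_num) (orderOf_dvd_of_pow_eq_one h8)
        have h1 := (Subgroup.zpowers (h * e)).card_mul_index
        rw [Nat.card_zpowers, hcard] at h1
        nlinarith [hoz, hidx, orderOf_pos (h * e)]
      obtain ⟨Φ, φ, X, ι, ϑ, H1, H2, -⟩ :=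
        AbelianTwoPowerClassification.exists_simple_degenerate_of_not_thin_of_le_finrank hcomm
          (show Module.finrank ℚ K = 2 ^ (4 + 1) by rw [hdeg]; norm_num) (by rw [hdeg]) hα
      exact H2 (hgood Φ φ H1)
    · /- `H ≅ Q₈`: every square lies in `{1, c}` — BAD by the Frattini file, contradicting GOOD -/
      have hk3' : k = 3 := by omega
      subst hk3'
      have hexp : ∀ h : H, h ^ 4 = 1 := by
        intro h
        have h1 : (f h) ^ 4 = 1 := by
          have := Monoid.pow_exponent_eq_one (f h)
          rw [QuaternionGroup.exponent] at this
          norm_num at this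
          exact this
        have h2 : f (h ^ 4) = f 1 := by rw [map_pow, h1, map_one]
        exact f.injective h2
      have hsq : ∀ g : K ≃ₐ[ℚ] K, g * g = 1 ∨ g * g = c := by
        intro g
        obtain ⟨h, hh, e, he, rfl⟩ := hdec g
        have hsq' : h * e * (h * e) = h * h := by
          calc h * e * (h * e) = h * (e * h) * e := by simp only [mul_assoc]
            _ = h * (h * e) * e := by rw [(hE e he).2 h]
            _ = h * h * (e * e) := by simp only [mul_assoc]
            _ = h * h := by rw [(hE e he).1, mul_one]
        rw [hsq']
        have h4 : h ^ 4 = 1 := by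
          have := congrArg Subtype.val (hexp ⟨h, hh⟩)
          simpa using this
        rcases hH2 h h4 with h' | h'
        · exact Or.inl h'
        · exact Or.inr h'
      obtain ⟨Φ, φ, X, ι, ϑ, H1, H2, -⟩ := exists_simple_degenerate_of_sq_subset hdeg hsq
      exact H2 (hgood Φ φ H1)

/-- **A unique involution ⟹ STRUCT** (with `E = 1`): `Gal(K/ℚ)` of order `2^n` with `c` its only involution is cyclic or generalised
quaternion (Rotman 5.46, gen 34). [cite: Rotman1995, Thm. 5.46] -/
theorem struct_of_involution_unique {n : ℕ} (hdeg : Module.finrank ℚ K = 2 ^ n)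
    (huniq : ∀ s : K ≃ₐ[ℚ] K, s * s = 1 → s ≠ 1 → s = (IsCMField.complexConj K).restrictScalars ℚ) :
    ∃ (H E : Subgroup (K ≃ₐ[ℚ] K)) (k : ℕ), H.IsComplement' E ∧ (IsCMField.complexConj K).restrictScalars ℚ ∈ H ∧
      (IsCMField.complexConj K).restrictScalars ℚ ∉ E ∧ (∀ e ∈ E, e * e = 1 ∧ ∀ g : K ≃ₐ[ℚ] K, g * e = e * g) ∧
      Nat.card E ≤ 2 ∧ Nat.card H = 2 ^ k ∧ (IsCyclic H ∨ (3 ≤ k ∧ Nonempty (H ≃* QuaternionGroup (2 ^ (k - 2))))) := by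
  classical
  set c := (IsCMField.complexConj K).restrictScalars ℚ with hc
  have hc1 : c ≠ 1 := model_complexConj_ne_one (MulEquiv.refl (K ≃ₐ[ℚ] K)) (by simp [hc])
  have hcard : Nat.card (K ≃ₐ[ℚ] K) = 2 ^ n := by
    rw [Nat.card_eq_fintype_card, card_model_eq_finrank (MulEquiv.refl (K ≃ₐ[ℚ] K)), hdeg]
  have h := isCyclic_or_nonempty_mulEquiv_quaternionGroup hcard
    (fun s t hs hs1 ht ht1 => (huniq s hs hs1).trans (huniq t ht ht1).symm)
  refine ⟨⊤, ⊥, n, Subgroup.isComplement'_top_bot, Subgroup.mem_top _, ?_, ?_, ?_, ?_, ?_⟩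
  · rw [Subgroup.mem_bot]; exact hc1
  · intro e he
    rw [Subgroup.mem_bot] at he
    subst he
    exact ⟨mul_one 1, fun g => by rw [mul_one, one_mul]⟩
  · rw [Subgroup.card_bot]; norm_num
  · rw [Subgroup.card_top, hcard]
  · rcases h with hcyc | ⟨hn3, ⟨f⟩⟩
    · left
      haveI := hcyc
      exact isCyclic_of_surjective (Subgroup.topEquiv (G := K ≃ₐ[ℚ] K)).symm
        (Subgroup.topEquiv (G := K ≃ₐ[ℚ] K)).symm.surjective
    · exact Or.inr ⟨hn3, ⟨(Subgroup.topEquiv (G := K ≃ₐ[ℚ] K)).trans f⟩⟩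

/-- **`Gal(K/ℚ)` abelian ⟹ STRUCT** for a GOOD Galois CM field of degree `32`: by gens 15–16 `K` is thin (a cyclic subgroup `⟨z⟩ ∋ c`
of index `≤ 2`), so every `y²` lies in `⟨z⟩`, whose only involution is `c` — (H2) — and all involutions are central.
[cite: Shimura1998, §6.2 Thm. 3 and §8.2 Prop. 26] [cite: Kubota1965, §2 and §4 Lemma 2] [cite: Gordon1999HodgeAVSurvey, §9.4.3] -/
theorem struct_of_comm_thirtytwo (hdeg : Module.finrank ℚ K = 32)
    (hgood : ∀ (Φ : CMType K) (φ : K →+* ℂ), IsPrimitive (ℂ ≃+* ℂ) Φ.1 φ → IsNondegenerate Φ)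
    (hcomm : ∀ g h : K ≃ₐ[ℚ] K, g * h = h * g) :
    ∃ (H E : Subgroup (K ≃ₐ[ℚ] K)) (k : ℕ), H.IsComplement' E ∧ (IsCMField.complexConj K).restrictScalars ℚ ∈ H ∧
      (IsCMField.complexConj K).restrictScalars ℚ ∉ E ∧ (∀ e ∈ E, e * e = 1 ∧ ∀ g : K ≃ₐ[ℚ] K, g * e = e * g) ∧
      Nat.card E ≤ 2 ∧ Nat.card H = 2 ^ k ∧ (IsCyclic H ∨ (3 ≤ k ∧ Nonempty (H ≃* QuaternionGroup (2 ^ (k - 2))))) := by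
  classical
  set c := (IsCMField.complexConj K).restrictScalars ℚ with hc
  have hcc : c * c = 1 := model_complexConj_mul_self (MulEquiv.refl (K ≃ₐ[ℚ] K)) (by simp [hc])
  have hc1 : c ≠ 1 := model_complexConj_ne_one (MulEquiv.refl (K ≃ₐ[ℚ] K)) (by simp [hc])
  have hcardF : Fintype.card (K ≃ₐ[ℚ] K) = 32 := by rw [card_model_eq_finrank (MulEquiv.refl (K ≃ₐ[ℚ] K)), hdeg]
  have hcard : Nat.card (K ≃ₐ[ℚ] K) = 2 ^ 5 := by rw [Nat.card_eq_fintype_card, hcardF]; norm_num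
  -- thin
  have hthin : ∃ z : K ≃ₐ[ℚ] K, c ∈ Subgroup.zpowers z ∧ (Subgroup.zpowers z).index ≤ 2 := by
    by_contra hα
    obtain ⟨Φ, φ, X, ι, ϑ, H1, H2, -⟩ :=
      AbelianTwoPowerClassification.exists_simple_degenerate_of_not_thin_of_le_finrank hcomm
        (show Module.finrank ℚ K = 2 ^ (4 + 1) by rw [hdeg]; norm_num) (by rw [hdeg]) hα
    exact H2 (hgood Φ φ H1)
  obtain ⟨z, hcz, hidx⟩ := hthin
  -- `orderOf z` is a power of `2`
  obtain ⟨m, -, hm⟩ := (Nat.dvd_prime_pow Nat.prime_two).1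
    (show orderOf z ∣ 2 ^ 5 by rw [← hcard]; exact orderOf_dvd_natCard z)
  -- every square lies in `⟨z⟩`
  have hsqmem : ∀ y : K ≃ₐ[ℚ] K, y * y ∈ Subgroup.zpowers z := by
    intro y
    have hidx' : (Subgroup.zpowers z).index = 1 ∨ (Subgroup.zpowers z).index = 2 := by
      have h0 : (Subgroup.zpowers z).index ≠ 0 := Subgroup.index_ne_zero_of_finite
      omega
    rcases hidx' with h1 | h2
    · rw [Subgroup.index_eq_one] at h1
      rw [h1]; exact Subgroup.mem_top _
    · exact Subgroup.mul_self_mem_of_index_two h2 y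
  refine struct_of_pow_four_sq_thirtytwo hdeg hgood (fun s _ g => hcomm g s) fun y hy4 => ?_
  by_cases hy : y * y = 1
  · exact Or.inl hy
  · right
    have hyy : y * y * (y * y) = 1 := by
      rw [show y * y * (y * y) = y ^ 4 by simp only [pow_succ, pow_zero, one_mul, mul_assoc]]; exact hy4
    exact involution_eq_of_mem_zpowers hm (hsqmem y) hyy hy hcz hcc hc1

end Field

end Summit.HodgeConjecture.CorCM.GaloisModels

end
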